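import Summits.ResolutionOfSingularities.ResolutionOfSingularities.Theorems.MarkedTransferCampaignW46MohWindowShadeFormalSeriesStatement
import HarnessLib

/-!
# [OURS · L1 W4.6 rung (iii)] The FORMALLY PURELY INSEPARABLE surface window — `J𝒪̂ = (z^p + F(u₀, u₁))` in SOME Cohen
# coordinates, `F ∈ K⟦u₀, u₁⟧` ANY power series: regime, rung, nesting (statement typing; closers by name in
# `…MohWindowShadeFormalInsepTerminates.lean`)

Cell `res-hironaka`, LADDER-RESOLUTION rung L (D-0089), slot W4.6 rung (iii) «purely inseparable `z^p = f(x, y)` with `ord f < 2p`»;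
seat res-L1-s46-pv-6 (gen 6). Host route MarkedTransfer (`HypersurfaceOrderReduction`, stmt-ResolutionOfSingularities-16155),
`--supports … --as helper`; kind definition (TYPED-OURS: 3 definitions + nesting). Sibling of `…MohWindowShadeFormalStatement.lean`
(p531101, polynomial `F`) and `…MohWindowShadeFormalSeriesStatement.lean` (p536496, power series `F` with ISOLATED SURFACE singularity).

WHAT IS TYPED — res-D-pv-008 AS s46-pv-14's clause (R1) VERBATIM («`∃ e : 𝒪̂_ξ ≃+* κ⟦X⟧, e(J𝒪̂) = (X₂^p + F), F free of X₂`»), with NO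
normalisation of `F` (no cleaning, no window, no Tjurina finiteness — everything the rung needs is read from o1's regime of record):
* `CampaignW46.MohWindowSurfaceFormalInsepAt p K R I` (ring level, `K : Type`): for SOME ring isomorphism `e : R̂ ≃+* K⟦z, u₀, u₁⟧`
  (`z = X none`, `u_l = X (some l)`), some `f₀` with `I = (f₀)`, some unit `w` and SOME POWER SERIES `F ∈ K⟦y₀, y₁⟧`:
  `e f₀ = w · (z^p + F(u₀, u₁))` (`F(u₀, u₁) = rename some F`).
* `CampaignW46.Regime.mohWindowSurfaceFormalInsep := regimeMohWindowSurfaceInsep ∧ ∀ ξ ∈ Sing(E), MohWindowSurfaceFormalInsepAt p K 𝒪_{Z,ξ} J_ξ`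
  — o1's purely inseparable surface window (isolated singular locus of closed points, window germ of exponent `E.b = p` at every singular
  point) whose singular germs are FORMALLY PURELY INSEPARABLE, at every stage.
* `CampaignW46.MohWindowSurfaceFormalInsepPermissiblyTerminates p K := PermissiblyTerminates Regime.mohWindowSurfaceFormalInsep`.
NESTING (pure logic): `FormalPoly ≤ FormalInsep` (`MohWindowSurfaceFormalPolyAt.formalInsepAt`), `FormalSeries ≤ FormalInsep`, `FormalInsep ≤ Insep`
(o1); hence o1's rung ⟹ this rung ⟹ gen 5's rungs (`…_of_insep`, `mohWindowSurfaceFormalPolyPermissiblyTerminates_of_formalInsep`,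
`mohWindowSurfaceFormalSeriesPermissiblyTerminates_of_formalInsep`); typed `Terminates ∧ TerminatesNabla` from the résumé-free rung.
CLOSER (separate file, this seat gen 6): `mohWindowSurfaceFormalInsepPermissiblyTerminates_of_isAlgClosed` via the POWER-SERIES PORT of the
shade model (`…MohWindowShadePS*.lean`: `Series.exists_coordinate_or_digit_curve_of_walk`).

WHY THIS IS THE SEED'S RUNG (iii). RESCUE-SEED W4.6 (iii) reads «purely inseparable `z^p = f` with `ord f < 2p`»: `f` a function of `(x, y)`
ALONE. o1's regime of record `regimeMohWindowSurfaceInsep` only asks `f ∈ (x, y)^d · 𝒪_{Z,ξ}` (so `f` may involve `z`: the non-purely-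
inseparable members `z^p + y^d + x^{2d} + z·x^a y^b` of s46-pv-14's H2-CENSUS); the conjunct typed here is exactly «purely inseparable, read
formally», with `f` an arbitrary power series in two of three Cohen coordinates (HOME/L/res-L1-s46-pv-6/GENERAL-REGIME-ANALYSIS.md §1 gap (A)).

(VAC) VACUITY SELF-CHECK. Not trivially true: `((z^p + x^d + y^d)·𝒪, p)` on `𝔸³_K`, `p < d < 2p`, inhabits `Regime.mohWindowSurfacePoly`
(p522062) hence, by the nesting theorems (p532859 `MohWindowSurfacePolyAt.formalPolyAt`, here `…formalInsepAt`), this regime over every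
algebraically closed `K`; arbitrarily long in-window chains exist (gen 2 `…TerminatesFinWitness`). Not trivially false: implied by o1's rung,
which has no in-tree refutation. The regime is LARGER than gen 5's two formal regimes (no normal form of `F` is demanded), so the rung here is
the STRONGEST of this seat's (iii) rungs. AI-written; AI review is weaker than expert review. H. Hironaka, ms. 2017-03-23, Th. 16.6 p.84
l.4–20, Th. 16.13 p.87 l.26–28 — scope only, under adjudication, not cited as fact [Hironaka2017]. Reference for the normal form:
H. Hauser, Bull. AMS 47 (2010) §§F–G [Hauser2010].
-/

noncomputable section

set_option linter.dupNamespace false -- mandated namespace of this single-conjunct summit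

open CategoryTheory AlgebraicGeometry TopologicalSpace IsLocalRing

namespace Summit.ResolutionOfSingularities.ResolutionOfSingularities.Theorems

namespace CampaignW46

open Literature.AlgebraicGeometry.Resolution
open Literature.AlgebraicGeometry.Resolution.Hauser2010
open Literature.AlgebraicGeometry.Hironaka2017.S02Preliminaries
open Literature.AlgebraicGeometry.Hironaka2017.Datum

variable {p : ℕ} [Fact p.Prime] {K : Type} [Field K] [CharP K p]

/-! ## §1 The predicate (ring level) -/

/-- [OURS · L1 W4.6 rung (iii)] replaces the role of the hypothesis «purely inseparable SURFACE `z^p = f(x, y)`» (RESCUE-SEED W4.6 (iii);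
Hauser 2010 §F) READ IN THE COMPLETION with an ARBITRARY power-series residual part — res-D-pv-008 AS s46-pv-14's clause (R1) verbatim; NOT a
statement of the manuscript. For a local ring `R` and an ideal `I`: for SOME ring isomorphism `e : R̂ ≃+* K⟦z, u₀, u₁⟧` (`z = X none`,
`u_l = X (some l)`), some `f₀` with `I = (f₀)`, some unit `w` and some power series `F ∈ K⟦y₀, y₁⟧`: `e f₀ = w · (z^p + F(u₀, u₁))`.
No cleaning, window or isolatedness is demanded of `F` (they are read from o1's regime of record where needed).
[cite: Hauser2010, §F (setting f = x^p + y^r g)] -/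
def MohWindowSurfaceFormalInsepAt (p : ℕ) (K : Type) [Field K] (R : Type) [CommRing R] [IsLocalRing R] (I : Ideal R) : Prop :=
  ∃ (e : AdicCompletion (maximalIdeal R) R ≃+* MvPowerSeries (Option (Fin 2)) K) (f₀ : R) (w : MvPowerSeries (Option (Fin 2)) K)
    (F : MvPowerSeries (Fin 2) K), I = Ideal.span {f₀} ∧ IsUnit w ∧
      e (algebraMap R (AdicCompletion (maximalIdeal R) R) f₀) =
        w * (MvPowerSeries.X none ^ p + MvPowerSeries.rename (some : Fin 2 → Option (Fin 2)) F)

omit [Fact p.Prime] [CharP K p] in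
/-- **Series (isolated surface singularity) ⇒ formally purely inseparable** (drop the normalisations). [folklore] -/
theorem MohWindowSurfaceFormalSeriesAt.formalInsepAt {R : Type} [CommRing R] [IsLocalRing R] {I : Ideal R}
    (h : MohWindowSurfaceFormalSeriesAt p K R I) : MohWindowSurfaceFormalInsepAt p K R I := by
  obtain ⟨e, f₀, w, F, -, -, -, hI, hw, hE, -⟩ := h
  exact ⟨e, f₀, w, F, hI, hw, hE⟩

omit [Fact p.Prime] [CharP K p] in
/-- **Poly ⇒ formally purely inseparable** (`F(u₀, u₁) = rename some ↑F`, `…FormalAnchor.eval₂_frame_eq_rename`). [folklore] -/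
theorem MohWindowSurfaceFormalPolyAt.formalInsepAt {R : Type} [CommRing R] [IsLocalRing R] {I : Ideal R}
    (h : MohWindowSurfaceFormalPolyAt p K R I) : MohWindowSurfaceFormalInsepAt p K R I := by
  obtain ⟨e, f₀, w, F, -, -, -, hI, hw, hE⟩ := h
  refine ⟨e, f₀, w, (F : MvPowerSeries (Fin 2) K), hI, hw, ?_⟩
  rw [hE, MohWindowShadeFormalAnchor.eval₂_frame_eq_rename]

/-! ## §2 The regime and the rung -/

/-- [OURS · L1 W4.6 rung (iii)] **Regime «formally purely inseparable surface window»** — replaces the role of the restriction (iii) of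
RESCUE-SEED W4.6 («purely inseparable `z^p = f(x, y)`, `ord f < 2p`») read in the completed local rings at EVERY stage; NOT a statement of the
manuscript: o1's `regimeMohWindowSurfaceInsep` (isolated singular locus of closed points; window germ `z^b + f`, `f ∈ (x, y)^d`,
`b = p < d < 2b`, at every singular point) AND `MohWindowSurfaceFormalInsepAt p K 𝒪_{Z,ξ} J_ξ` at every `ξ ∈ Sing(E)`. [folklore] -/
def Regime.mohWindowSurfaceFormalInsep : Regime p K := fun A E =>
  regimeMohWindowSurfaceInsep A E ∧ ∀ ξ ∈ E.sing, MohWindowSurfaceFormalInsepAt p K (A.Z.presheaf.stalk ξ) (stalkIdeal E.J ξ)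

/-- Pure logic: the formally purely inseparable regime is a sub-regime of o1's regime of record. [folklore] -/
theorem Regime.mohWindowSurfaceFormalInsep_le (A : AmbientDatum p K) (E : IdealExponent A.Z)
    (h : Regime.mohWindowSurfaceFormalInsep A E) : regimeMohWindowSurfaceInsep A E :=
  h.1

/-- Pure logic: gen 5's formally-polynomial regime (p531101) is a sub-regime. [folklore] -/
theorem Regime.mohWindowSurfaceFormalPoly_le_formalInsep (A : AmbientDatum p K) (E : IdealExponent A.Z)
    (h : Regime.mohWindowSurfaceFormalPoly A E) : Regime.mohWindowSurfaceFormalInsep A E :=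
  ⟨h.1, fun ξ hξ => (h.2 ξ hξ).formalInsepAt⟩

/-- Pure logic: gen 5's series regime with isolated surface singularity (p536496) is a sub-regime. [folklore] -/
theorem Regime.mohWindowSurfaceFormalSeries_le_formalInsep (A : AmbientDatum p K) (E : IdealExponent A.Z)
    (h : Regime.mohWindowSurfaceFormalSeries A E) : Regime.mohWindowSurfaceFormalInsep A E :=
  ⟨h.1, fun ξ hξ => (h.2 ξ hξ).formalInsepAt⟩

/-- [OURS · L1 W4.6 rung (iii)] **RUNG (iii), FORMALLY PURELY INSEPARABLE SURFACE WINDOW, résumé-free** — replaces the role of the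
termination clause of Th. 16.13 p.87 l.26–28 («repeatedly but finitely many times») for the typed Th. 16.6 procedure restricted, at every
stage, to `Regime.mohWindowSurfaceFormalInsep`; NOT a statement of the manuscript: there is NO infinite §2.1-permissible sequence (standard
ideal exponents, permissible centres — here single closed points —, blow-ups, controlled transforms) all of whose stages lie in the regime
(`PermissiblyTerminates`). To be PROVED over algebraically closed `K` in `…MohWindowShadeFormalInsepTerminates.lean` (power-series port of the
shade model). VACUITY: module docstring (VAC). [folklore] -/
def MohWindowSurfaceFormalInsepPermissiblyTerminates (p : ℕ) [Fact p.Prime] (K : Type) [Field K] [CharP K p] : Prop :=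
  PermissiblyTerminates (Regime.mohWindowSurfaceFormalInsep (p := p) (K := K))

/-! ## §3 Nesting of the rungs (pure logic) -/

/-- o1's rung `MohWindowSurfaceInsepPermissiblyTerminates` implies this rung (antitonicity in the regime). [folklore] -/
theorem mohWindowSurfaceFormalInsepPermissiblyTerminates_of_insep (h : MohWindowSurfaceInsepPermissiblyTerminates p K) :
    MohWindowSurfaceFormalInsepPermissiblyTerminates p K :=
  permissiblyTerminates_antitone (fun A E hAE => Regime.mohWindowSurfaceFormalInsep_le A E hAE) h

/-- This rung implies gen 5's formally-polynomial rung (p531101). [folklore] -/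
theorem mohWindowSurfaceFormalPolyPermissiblyTerminates_of_formalInsep (h : MohWindowSurfaceFormalInsepPermissiblyTerminates p K) :
    MohWindowSurfaceFormalPolyPermissiblyTerminates p K :=
  permissiblyTerminates_antitone (fun A E hAE => Regime.mohWindowSurfaceFormalPoly_le_formalInsep A E hAE) h

/-- This rung implies gen 5's series rung with isolated surface singularity (p536496). [folklore] -/
theorem mohWindowSurfaceFormalSeriesPermissiblyTerminates_of_formalInsep (h : MohWindowSurfaceFormalInsepPermissiblyTerminates p K) :
    MohWindowSurfaceFormalSeriesPermissiblyTerminates p K :=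
  permissiblyTerminates_antitone (fun A E hAE => Regime.mohWindowSurfaceFormalSeries_le_formalInsep A E hAE) h

/-- **The typed rungs from the résumé-free rung**: for EVERY notion instance `N` and reading `Rd`, `Terminates ∧ TerminatesNabla` on the
regime. [folklore] -/
theorem terminates_and_terminatesNabla_of_mohWindowSurfaceFormalInsepPermissiblyTerminates
    (h : MohWindowSurfaceFormalInsepPermissiblyTerminates p K) (n : ℕ) (N : Notions.{0} n) (Rd : Reading p K N) :
    Terminates N Rd (Regime.mohWindowSurfaceFormalInsep (p := p) (K := K)) ∧
      TerminatesNabla N Rd (Regime.mohWindowSurfaceFormalInsep (p := p) (K := K)) :=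
  ⟨terminates_of_permissiblyTerminates N Rd h, terminatesNabla_of_terminates (terminates_of_permissiblyTerminates N Rd h)⟩

/-- Pure logic: the rung on the regime gives the rung on its intersection with «rational singular points» (gen 5's `Regime.rationalSing`,
the form used over perfect non-closed fields). [folklore] -/
theorem mohWindowSurfaceFormalInsep_rationalSing_of (h : MohWindowSurfaceFormalInsepPermissiblyTerminates p K) :
    PermissiblyTerminates (Regime.inter (Regime.mohWindowSurfaceFormalInsep (p := p) (K := K)) Regime.rationalSing) :=
  permissiblyTerminates_antitone (fun _ _ hAE => hAE.1) h

end CampaignW46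

end Summit.ResolutionOfSingularities.ResolutionOfSingularities.Theorems

end
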